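/-
Copyright (c) 2026 the pub-hodgecm-mathlib formalisation cell (harness21).  Prover seat hodgecm-mathlib-F0P3b-p01 (g25); offered to the E1 keeper ∕ dealer
F0P3a-p03 (g30) as row 40⁗γ (sigsheet-first, rule 20): input (b) of ★ row 40″ `F0P3cStCharTSK2PiTwoSelfExtSplitSentence` from the smaller PRINT input «`r_P A` is the `χ`-line».
-/
import Literature.NumberTheory.Automorphic.JacquetLineExponents        -- ★ `Representation.jacquetMap_normalizedJacquet` (brings ★ `JacquetModule`: `jacquetMap`, `normalizedJacquet`)
import Literature.NumberTheory.Automorphic.JacquetModuleExactProofs     -- ★ `Representation.jacquetMap_exact`, `jacquetMap_surjective` (right exactness of `r_P`)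
import HarnessLib

/-!
# The Jacquet functor carries a self-extension of `A` to a self-extension of the `χ`-line (when `r_P A` is the `χ`-line)

Generic (topological group `G`, parabolic triple `t = (P, M, N)`, complex coefficients), ★ `JacquetModule` ∕ `JacquetLineExponents` ∕ `JacquetModuleExactProofs`
+ Mathlib, THEOREMS ONLY (no `def`, no instance, no named fact).  Namespace `Literature.NumberTheory.Automorphic`.  Cell `pub/hodgecm-mathlib`, crux H413 =
`stmt-HodgeConjecture-24833` (`--supports` lane): the hypothesis block (b) «`r_P τ` is a self-extension of the `χ`-line» of ★ row 40″
`F0P3cStCharTSK2PiTwoSelfExtSplitSentence.selfExtension_splits_of_jacquet_selfExtension` — the letters `pJ hquot hker u₀ e hu₀ he hline hfree` — DERIVED from the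
self-extension `0 → A —ι→ τ —p→ A → 0` itself and the smaller printed input «`r_P A` is the `χ`-line» (a spanning vector `a₀` with coordinate `qA` on which `M` acts by `χ`).
Seat F0P3b-p01 (g25).

THE MATHEMATICS (right exactness of `r_P` ★ + injectivity of `r_P ι`, which at the CM datum is ★ `jacquetMap_cmBorel_injective`).  Put `pJ := qA ∘ r_P(p)` and
`e := r_P(ι) a₀`.  Then `pJ (r_P τ (m) u) = χ(m) pJ u` (★ `jacquetMap_normalizedJacquet`); `pJ e = 0` (`p ∘ ι = 0`); `c • e = 0 ⇒ c = 0` (`r_P ι` injective, `qA a₀ = 1`);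
`pJ w = 0 ⇒ w ∈ ker r_P(p) = im r_P(ι) = ℂ e` (★ `jacquetMap_exact`); on that line `M` acts by `χ`; and `u₀` with `pJ u₀ = 1` exists (★ `jacquetMap_surjective`).
* §1 `normalizedJacquet_eq_smul_of_line` (the `χ`-line: `M` acts by `χ` on all of `r_P A`), `exists_coord_of_finrank_eq_one` (the `(a₀, qA)` letters from `finrank = 1`).
* §2 `coord_jacquetMap_normalizedJacquet` (hquot), `coord_jacquetMap_jacquetMap_eq_zero` (he), `eq_zero_of_smul_jacquetMap_eq_zero` (hfree),
  `exists_eq_smul_of_coord_jacquetMap_eq_zero` (hline), `normalizedJacquet_eq_smul_of_coord_jacquetMap_eq_zero` (hker), `exists_coord_jacquetMap_eq_one` (hu₀),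
  **`exists_jacquet_selfExtension_of_selfExtension`** (the (b) package in the SENTENCE's order).
[cite: BernsteinZelevinsky1977, §1.8; §2.3; Prop. 1.9 (a)] [cite: Casselman1995, §3.1; Prop. 3.2.3] [cite: Keys1984, §3 pp. 118–119]
HONEST LABEL: count-neutral generic layer; HC_CM is proved only modulo the printed citations of that programme until its rung 0 closes.

## References
* [BernsteinZelevinsky1977] I. N. Bernstein, A. V. Zelevinsky, *Induced representations of reductive p-adic groups I*, Ann. Sci. ÉNS 10 (1977), §1.8, §2.3, Prop. 1.9 (a).
* [Casselman1995] W. Casselman, *Introduction to the theory of admissible representations of p-adic reductive groups* (1995), §3.1, Prop. 3.2.3.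
* [Keys1984] D. Keys, *Principal series representations of special unitary groups over local fields*, Compositio Math. 51 (1984), §3 pp. 118–119.
-/

set_option autoImplicit false

noncomputable section

namespace Literature.NumberTheory.Automorphic

open _root_.Representation

variable {G : Type*} [Group G] [TopologicalSpace G] [IsTopologicalGroup G] (t : ParabolicTriple G) [LocallyCompactSpace ↥t.P]
  {VA X : Type*} [AddCommGroup VA] [Module ℂ VA] [AddCommGroup X] [Module ℂ X]
  (σ : Representation ℂ G VA) (τ : Representation ℂ G X) (χ : ↥t.M →* ℂ)

/-! ## §1 The `χ`-line -/

/-- **THE `(a₀, qA)` LETTERS FROM `finrank = 1`**: a one-dimensional space has a vector `a₀` and a linear coordinate `qA` with `qA a₀ = 1` and `w = qA w • a₀` for all `w`.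
[cite: Casselman1995, §3.1] -/
theorem exists_coord_of_finrank_eq_one {W : Type*} [AddCommGroup W] [Module ℂ W] (h : Module.finrank ℂ W = 1) :
    ∃ (a₀ : W) (qA : W →ₗ[ℂ] ℂ), qA a₀ = 1 ∧ ∀ w : W, w = qA w • a₀ := by
  haveI : Nontrivial W := Module.nontrivial_of_finrank_eq_succ h
  obtain ⟨v, hv⟩ := exists_ne (0 : W)
  let b := FiniteDimensional.basisSingleton Unit h v hv
  refine ⟨v, b.coord (), ?_, fun w => ?_⟩
  · have := b.repr_self ()
    rw [FiniteDimensional.basisSingleton_apply] at this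
    rw [Module.Basis.coord_apply, this, Finsupp.single_eq_same]
  · have hw := b.sum_repr w
    rw [Fintype.sum_unique, FiniteDimensional.basisSingleton_apply] at hw
    rw [Module.Basis.coord_apply]
    exact hw.symm

variable {a₀ : (t.restrict σ).Coinvariants} (qA : (t.restrict σ).Coinvariants →ₗ[ℂ] ℂ) (hqa₀ : qA a₀ = 1)
  (hspan : ∀ w : (t.restrict σ).Coinvariants, w = qA w • a₀) (hchar : ∀ m : ↥t.M, σ.normalizedJacquet t m a₀ = χ m • a₀)

include hspan hchar in
/-- **ON THE `χ`-LINE `M` ACTS BY `χ` EVERYWHERE**: `r_P σ (m) w = χ(m) w` for all `w` (write `w = qA w • a₀`). [cite: BernsteinZelevinsky1977, §2.3] -/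
theorem normalizedJacquet_eq_smul_of_line (m : ↥t.M) (w : (t.restrict σ).Coinvariants) : σ.normalizedJacquet t m w = χ m • w := by
  have hw := hspan w
  rw [hw, map_smul, hchar, smul_comm]

/-! ## §2 The self-extension of the `χ`-line inside `r_P τ` -/

variable (ι : σ.IntertwiningMap τ) (p : τ.IntertwiningMap σ)
  (hι : Function.Injective (jacquetMap t ι)) (hp : Function.Surjective p) (hexact : LinearMap.ker p.toLinearMap = LinearMap.range ι.toLinearMap)

include hspan hchar in
/-- **(hquot)** `pJ (r_P τ (m) u) = χ(m) · pJ u` for `pJ := qA ∘ r_P(p)` (★ `jacquetMap_normalizedJacquet` + §1). [cite: BernsteinZelevinsky1977, §1.8; §2.3] -/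
theorem coord_jacquetMap_normalizedJacquet (m : ↥t.M) (u : (t.restrict τ).Coinvariants) :
    qA (jacquetMap t p (τ.normalizedJacquet t m u)) = χ m * qA (jacquetMap t p u) := by
  rw [jacquetMap_normalizedJacquet, normalizedJacquet_eq_smul_of_line t σ χ qA hspan hchar, map_smul, smul_eq_mul]

omit [TopologicalSpace G] [IsTopologicalGroup G] [LocallyCompactSpace ↥t.P] in
include hexact in
/-- `p ∘ ι = 0` on Jacquet modules: `r_P(p) (r_P(ι) x) = 0`. [cite: BernsteinZelevinsky1977, §1.8] -/
theorem jacquetMap_jacquetMap_eq_zero (x : (t.restrict σ).Coinvariants) : jacquetMap t p (jacquetMap t ι x) = 0 := by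
  obtain ⟨a, rfl⟩ := Coinvariants.mk_surjective _ x
  have h0 : p (ι a) = 0 := by
    have ha : ι a ∈ LinearMap.ker p.toLinearMap := hexact ▸ LinearMap.mem_range_self ι.toLinearMap a
    exact ha
  rw [jacquetMap_mk, jacquetMap_mk, h0, map_zero]

omit [TopologicalSpace G] [IsTopologicalGroup G] [LocallyCompactSpace ↥t.P] in
include hexact in
/-- **(he)** `pJ e = 0` for `e := r_P(ι) a₀`. [cite: BernsteinZelevinsky1977, §1.8] -/
theorem coord_jacquetMap_jacquetMap_eq_zero (x : (t.restrict σ).Coinvariants) : qA (jacquetMap t p (jacquetMap t ι x)) = 0 := by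
  rw [jacquetMap_jacquetMap_eq_zero t σ τ ι p hexact, map_zero]

omit [TopologicalSpace G] [IsTopologicalGroup G] [LocallyCompactSpace ↥t.P] in
include hqa₀ hι in
/-- **(hfree)** `c • e = 0 ⇒ c = 0` for `e := r_P(ι) a₀` (`r_P ι` injective, `qA a₀ = 1`). [cite: BernsteinZelevinsky1977, Prop. 1.9 (a)] [cite: Casselman1995, Prop. 3.2.3] -/
theorem eq_zero_of_smul_jacquetMap_eq_zero (c : ℂ) (hc : c • jacquetMap t ι a₀ = 0) : c = 0 := by
  rw [← map_smul] at hc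
  have h0 : c • a₀ = 0 := hι (by rw [hc, map_zero])
  have := congrArg qA h0
  rwa [map_smul, hqa₀, smul_eq_mul, mul_one, map_zero] at this

omit [TopologicalSpace G] [IsTopologicalGroup G] [LocallyCompactSpace ↥t.P] in
include hspan hp hexact in
/-- **(hline)** `pJ w = 0 ⇒ w = c • e`: `r_P(p) w = (pJ w) • a₀ = 0`, so `w ∈ ker r_P(p) = im r_P(ι)` (★ right exactness `jacquetMap_exact`) and `im r_P(ι) = ℂ · e`.
[cite: BernsteinZelevinsky1977, §1.8; Prop. 1.9 (a)] [cite: Casselman1995, Prop. 3.2.3] -/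
theorem exists_eq_smul_of_coord_jacquetMap_eq_zero (w : (t.restrict τ).Coinvariants) (hw : qA (jacquetMap t p w) = 0) :
    ∃ c : ℂ, w = c • jacquetMap t ι a₀ := by
  have hfg : Function.Exact ι p := fun y => by
    change p.toLinearMap y = 0 ↔ _
    rw [← LinearMap.mem_ker, hexact, LinearMap.mem_range]
    rfl
  have h0 : jacquetMap t p w = 0 := by rw [hspan (jacquetMap t p w), hw, zero_smul]
  obtain ⟨x, hx⟩ := ((jacquetMap_exact t ι p hfg hp) w).1 h0
  exact ⟨qA x, by rw [← hx, ← map_smul, ← hspan x]⟩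

include hspan hchar hp hexact in
/-- **(hker)** on `ker pJ = ℂ · e` the Levi acts by `χ`: `pJ u = 0 ⇒ r_P τ (m) u = χ(m) u` (★ `jacquetMap_normalizedJacquet` + §1).
[cite: BernsteinZelevinsky1977, §1.8; §2.3] -/
theorem normalizedJacquet_eq_smul_of_coord_jacquetMap_eq_zero (m : ↥t.M) (u : (t.restrict τ).Coinvariants) (hu : qA (jacquetMap t p u) = 0) :
    τ.normalizedJacquet t m u = χ m • u := by
  obtain ⟨c, rfl⟩ := exists_eq_smul_of_coord_jacquetMap_eq_zero t σ τ qA hspan ι p hp hexact u hu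
  rw [map_smul, ← jacquetMap_normalizedJacquet, normalizedJacquet_eq_smul_of_line t σ χ qA hspan hchar, map_smul, smul_comm]

omit [TopologicalSpace G] [IsTopologicalGroup G] [LocallyCompactSpace ↥t.P] in
include hqa₀ hp in
/-- **(hu₀)** a base vector: `∃ u₀, pJ u₀ = 1` (★ `jacquetMap_surjective`). [cite: BernsteinZelevinsky1977, §1.8] -/
theorem exists_coord_jacquetMap_eq_one : ∃ u₀ : (t.restrict τ).Coinvariants, qA (jacquetMap t p u₀) = 1 := by
  obtain ⟨u₀, hu₀⟩ := jacquetMap_surjective t p hp a₀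
  exact ⟨u₀, by rw [hu₀, hqa₀]⟩

include hqa₀ hspan hchar hι hp hexact in
/-- **THE JACQUET FUNCTOR CARRIES A SELF-EXTENSION OF `A` TO A SELF-EXTENSION OF THE `χ`-LINE.**  For `0 → A —ι→ τ —p→ A → 0` (`p` onto, `ker p = im ι`, `r_P ι`
injective — at the CM datum ★ `jacquetMap_cmBorel_injective`) with `r_P A` the `χ`-line (`a₀`, `qA`, `qA a₀ = 1`, `w = qA w • a₀`, `r_P A (m) a₀ = χ(m) a₀`), the Jacquet module
`r_P τ` carries the package (b) of ★ row 40″ `selfExtension_splits_of_jacquet_selfExtension`, in its order: `pJ`, (hquot), (hker), `u₀`, `e`, (hu₀), (he), (hline), (hfree).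
[cite: BernsteinZelevinsky1977, §1.8; §2.3; Prop. 1.9 (a)] [cite: Casselman1995, §3.1; Prop. 3.2.3] [cite: Keys1984, §3 pp. 118–119] -/
theorem exists_jacquet_selfExtension_of_selfExtension :
    ∃ (pJ : (t.restrict τ).Coinvariants →ₗ[ℂ] ℂ) (u₀ e : (t.restrict τ).Coinvariants),
      (∀ (m : ↥t.M) (u : (t.restrict τ).Coinvariants), pJ (τ.normalizedJacquet t m u) = χ m * pJ u) ∧
      (∀ (m : ↥t.M) (u : (t.restrict τ).Coinvariants), pJ u = 0 → τ.normalizedJacquet t m u = χ m • u) ∧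
      pJ u₀ = 1 ∧ pJ e = 0 ∧ (∀ w : (t.restrict τ).Coinvariants, pJ w = 0 → ∃ c : ℂ, w = c • e) ∧ (∀ c : ℂ, c • e = 0 → c = 0) := by
  obtain ⟨u₀, hu₀⟩ := exists_coord_jacquetMap_eq_one t σ τ qA hqa₀ p hp
  refine ⟨qA.comp (jacquetMap t p).toLinearMap, u₀, jacquetMap t ι a₀, fun m u => ?_, fun m u hu => ?_, hu₀, ?_, fun w hw => ?_, fun c hc => ?_⟩
  · exact coord_jacquetMap_normalizedJacquet t σ τ χ qA hspan hchar p m u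
  · exact normalizedJacquet_eq_smul_of_coord_jacquetMap_eq_zero t σ τ χ qA hspan hchar ι p hp hexact m u hu
  · exact coord_jacquetMap_jacquetMap_eq_zero t σ τ qA ι p hexact a₀
  · exact exists_eq_smul_of_coord_jacquetMap_eq_zero t σ τ qA hspan ι p hp hexact w hw
  · exact eq_zero_of_smul_jacquetMap_eq_zero t σ τ qA hqa₀ ι hι c hc

omit [TopologicalSpace G] [IsTopologicalGroup G] [LocallyCompactSpace ↥t.P] in
/-- `r_P(ι) [a] = [ι a]`: the image of a class under the Jacquet map of `ι` (★ `jacquetMap_mk`, restated for the consumer's `Coinvariants.mk` spelling).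
[cite: BernsteinZelevinsky1977, §1.8] -/
theorem jacquetMap_mk_eq (a : VA) : jacquetMap t ι (Coinvariants.mk (t.restrict σ) a) = Coinvariants.mk (t.restrict τ) (ι a) := by
  rw [jacquetMap_mk]

include hqa₀ hspan hchar hι hp hexact in
/-- **ED. 2 (E1 row 68-γ′, F0P3b-p01 (g26)) — THE SAME PACKAGE WITH THE SUB-LINE CONJUNCTS of the K4′ SENTENCE** (★
`F0P3cStCharTSK4PrimeSelfExtSplitSentence.selfExtension_splits_of_jacquet_selfExtension_of_jet_intertwiner`, binders `hιker`, `hιe`): the witnesses of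
`exists_jacquet_selfExtension_of_selfExtension` are `pJ := qA ∘ r_P(p)` and `e := r_P(ι) a₀`, so IN ADDITION `pJ [ι a] = 0` for every `a` (`p ∘ ι = 0` on Jacquet modules,
`coord_jacquetMap_jacquetMap_eq_zero`) and `[ι a] = e` for some `a` (any lift `a` of `a₀`): the line `ker pJ = ℂ · e` IS the image `r_P(ι)(r_P A)`.  Output order = the K4′
SENTENCE's (b)-block: `pJ`, (hquot), (hker), `u₀`, `e`, (hu₀), (he), (hline), (hfree), (hιker), (hιe).
[cite: BernsteinZelevinsky1977, §1.8; §2.3; Prop. 1.9 (a)] [cite: Casselman1995, §3.1; Prop. 3.2.3] [cite: Keys1984, §3 pp. 118–119; §4 Thm. 3 p. 120] -/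
theorem exists_jacquet_selfExtension_of_selfExtension_sub :
    ∃ (pJ : (t.restrict τ).Coinvariants →ₗ[ℂ] ℂ) (u₀ e : (t.restrict τ).Coinvariants),
      (∀ (m : ↥t.M) (u : (t.restrict τ).Coinvariants), pJ (τ.normalizedJacquet t m u) = χ m * pJ u) ∧
      (∀ (m : ↥t.M) (u : (t.restrict τ).Coinvariants), pJ u = 0 → τ.normalizedJacquet t m u = χ m • u) ∧
      pJ u₀ = 1 ∧ pJ e = 0 ∧ (∀ w : (t.restrict τ).Coinvariants, pJ w = 0 → ∃ c : ℂ, w = c • e) ∧ (∀ c : ℂ, c • e = 0 → c = 0) ∧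
      (∀ a : VA, pJ (Coinvariants.mk (t.restrict τ) (ι a)) = 0) ∧ (∃ a : VA, Coinvariants.mk (t.restrict τ) (ι a) = e) := by
  obtain ⟨u₀, hu₀⟩ := exists_coord_jacquetMap_eq_one t σ τ qA hqa₀ p hp
  obtain ⟨a, ha⟩ := Coinvariants.mk_surjective (t.restrict σ) a₀
  refine ⟨qA.comp (jacquetMap t p).toLinearMap, u₀, jacquetMap t ι a₀, fun m u => ?_, fun m u hu => ?_, hu₀, ?_, fun w hw => ?_, fun c hc => ?_,
    fun a' => ?_, ⟨a, ?_⟩⟩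
  · exact coord_jacquetMap_normalizedJacquet t σ τ χ qA hspan hchar p m u
  · exact normalizedJacquet_eq_smul_of_coord_jacquetMap_eq_zero t σ τ χ qA hspan hchar ι p hp hexact m u hu
  · exact coord_jacquetMap_jacquetMap_eq_zero t σ τ qA ι p hexact a₀
  · exact exists_eq_smul_of_coord_jacquetMap_eq_zero t σ τ qA hspan ι p hp hexact w hw
  · exact eq_zero_of_smul_jacquetMap_eq_zero t σ τ qA hqa₀ ι hι c hc
  · change qA (jacquetMap t p (Coinvariants.mk (t.restrict τ) (ι a'))) = 0
    rw [← jacquetMap_mk_eq t σ τ ι a']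
    exact coord_jacquetMap_jacquetMap_eq_zero t σ τ qA ι p hexact _
  · rw [← jacquetMap_mk_eq t σ τ ι a, ha]

end Literature.NumberTheory.Automorphic

end
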